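import Summits.CriticalPhenomena.PercolationContinuityZ3.Theorems.PercNearOneGluingNoHeavyLowerTailCILReachFunctionalExpansion
import Summits.CriticalPhenomena.PercolationContinuityZ3.Theorems.PercNearOneGluingNoHeavyLowerTailCILOffObserverTransport
import HarnessLib

/-!
# `NoHeavyLowerTail` (stmt-CriticalPhenomena-4575) — DOUBLE star expansion of a relay's lightness over two pendant observers

Support file (prover `prim-hp-3`, hull-port line; `--supports stmt-CriticalPhenomena-4575`).  No definitions, no named facts, no sorries.
Step 2 of the assembly recipe for the overtaking bound (run/shared/lean/prim/prim-hp-3/PROOF-OVERTAKING-BOUND.md §6): for two non-relay observers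
`s₁ ≠ s₂` whose positive pairs end in the port sets `P₁`, `P₂ ⊆ A`, and a relay `v`,

  `I_w(v) = Σ_{S ⊆ P₂} μ_w(σ²_S) · Σ_{T ⊆ P₁} μ_{w∖s₂}(σ¹_T) · μ_{(w∖s₂)∖s₁}{ω | two-block lightness of v with blocks T and S}`,

where `w∖s = fun e => if s ∈ e then 0 else w e` switches the pairs at `s` off, `σ` are the star events, and the two-block lightness event is the
honest event (of `ω` itself, no `ω ∖ o`) "at most `j` relays `z` with `R(v,z)`", `R` = the reachability relation of `ω` closed through `T` and then
through `S` (written out).  Ingredients: `Hyperedge.lightness_star_expansion` (at `s₂`), `Hyperedge.real_reachFunctional_offObserver` (twice),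
`Hyperedge.gluedLightness_star_expansion` (at `s₁`).  The cells are now plain `prodBernoulli` events, ready for the glue bridges
(`Hyperedge.real_glueList_reachFunctional`) and the cell inequality `HullPort.lightness_margin_glue_ge_max` (Steps 3–4).
-/

noncomputable section

namespace Summit.CriticalPhenomena.PercolationContinuityZ3.Theorems

open MeasureTheory Set Literature.Probability.LatticeModels Literature.Probability.Percolation
open scoped Classical BigOperators

variable {n : ℕ}

namespace Hyperedge

/-- **Double star expansion of a relay's lightness.**  See the file header. [folklore] -/
theorem lightness_double_star_expansion (w : Sym2 (Fin n) → unitInterval) (A : Finset (Fin n)) (s₁ s₂ v : Fin n)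
    (P₁ P₂ : Finset (Fin n)) (j : ℕ) (h1A : s₁ ∉ A) (h2A : s₂ ∉ A) (hvA : v ∈ A) (h1P : s₁ ∉ P₁) (h2P : s₂ ∉ P₂)
    (hP2A : P₂ ⊆ A) (hobs₁ : ∀ y, y ≠ s₁ → y ∉ P₁ → w s(s₁, y) = 0) (hobs₂ : ∀ y, y ≠ s₂ → y ∉ P₂ → w s(s₂, y) = 0) :
    (prodBernoulli w).real {ω : BondConfig (Fin n) | (A.filter fun z => ω ∈ openConn v z).card ≤ j} =
      ∑ S ∈ P₂.powerset, (prodBernoulli w).real (starEvent s₂ (↑S : Set (Fin n))) *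
        ∑ T ∈ P₁.powerset,
          (prodBernoulli (fun e => if s₂ ∈ e then (0 : unitInterval) else w e)).real (starEvent s₁ (↑T : Set (Fin n))) *
          (prodBernoulli (fun e => if s₁ ∈ e then (0 : unitInterval) else if s₂ ∈ e then (0 : unitInterval) else w e)).real
            {ω : BondConfig (Fin n) |
              (A.filter fun z =>
                ((openGraph ω).Reachable v z ∨
                  ((∃ c ∈ T, (openGraph ω).Reachable c v) ∧ ∃ c' ∈ T, (openGraph ω).Reachable c' z)) ∨
                ((∃ s ∈ S, (openGraph ω).Reachable s v ∨
                    ((∃ c ∈ T, (openGraph ω).Reachable c s) ∧ ∃ c' ∈ T, (openGraph ω).Reachable c' v)) ∧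
                  ∃ s' ∈ S, (openGraph ω).Reachable s' z ∨
                    ((∃ c ∈ T, (openGraph ω).Reachable c s') ∧ ∃ c' ∈ T, (openGraph ω).Reachable c' z))).card ≤ j} := by
  set w₂ : Sym2 (Fin n) → unitInterval := fun e => if s₂ ∈ e then (0 : unitInterval) else w e with hw₂
  -- (1) expand at `s₂`
  rw [lightness_star_expansion w A s₂ v P₂ j h2A hvA h2P hobs₂]
  refine Finset.sum_congr rfl fun S hS => ?_
  have hSA : S ⊆ A := (Finset.mem_powerset.1 hS).trans hP2A
  congr 1
  -- (2) transport the inner event off `s₂`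
  have t1 := real_reachFunctional_offObserver w s₂
    (fun R => (A.filter fun z => R v z ∨ ((∃ b ∈ S, R b v) ∧ ∃ b' ∈ S, R b' z)).card ≤ j)
  beta_reduce at t1
  -- (3) expand at `s₁` under `w ∖ s₂`
  have hobs₁' : ∀ y, y ≠ s₁ → y ∉ P₁ → w₂ s(s₁, y) = 0 := by
    intro y hy hyP
    simp only [hw₂]
    split_ifs with h
    · rfl
    · exact hobs₁ y hy hyP
  have g1 := gluedLightness_star_expansion w₂ A s₁ v P₁ S j h1A hvA hSA h1P hobs₁'
  -- chain (1)→(2)→(3); `convert` absorbs the syntactic differences of the `Finset.filter` instances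
  refine Eq.trans ?_ (Eq.trans g1 ?_)
  · convert t1
  refine Finset.sum_congr rfl fun T _ => ?_
  congr 1
  -- (4) transport the inner event off `s₁`
  have t2 := real_reachFunctional_offObserver w₂ s₁
    (fun R => (A.filter fun z =>
      (R v z ∨ ((∃ c ∈ T, R c v) ∧ ∃ c' ∈ T, R c' z)) ∨
        ((∃ s ∈ S, R s v ∨ ((∃ c ∈ T, R c s) ∧ ∃ c' ∈ T, R c' v)) ∧
          ∃ s' ∈ S, R s' z ∨ ((∃ c ∈ T, R c s') ∧ ∃ c' ∈ T, R c' z))).card ≤ j)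
  beta_reduce at t2
  convert t2

end Hyperedge

end Summit.CriticalPhenomena.PercolationContinuityZ3.Theorems
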